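import Literature.MathematicalPhysics.QuantumFieldTheory.Balaban1983to89.B13ResidualSlotProbe9
import Literature.MathematicalPhysics.QuantumFieldTheory.Balaban1983to89.Node00.CarriersY
import Literature.MathematicalPhysics.QuantumFieldTheory.Balaban1983to89.B9PinCarriersNonVacuity
import Summits.QuantumFields.YangMills.Theorems.BalabanUVNodesN08AtRecord9CB10

/-!
# DAG node N10 · [B13] — THE STUB OF RECORD `YMDAG.UVSplit.S_N10 Rec` READ AT NODE 00's CUMULATIVE CARRIER-PIN RECORDS `₉CB10` ∕ `₉CB10Y`
# ([B10] run family pinned, `Node00/CarriersB10`; def-Y's [B9] bundle pinned on top, `Node00/CarriersY`; the B13 group still residual):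
# there `b10` IS N08's slot of record `Node00.PrintedUV3V N L` — so the N10 ∀-stub DENIES that slot at every record, N08's and N10's ∀-stubs are JOINTLY
# UNSATISFIABLE (no hypothesis on Bałaban's theorems), and — the named instance `not_s_N10_record₉CB10Y` — given K0-inhabitation and N08's object gap the stub is FALSE

Cell `pub-ymgap`, YM-PLAN Track A (HUMAN RULING D-0062), seat `pub-ymgap-dag-p2` = n10-a (generation 7; KNIT-BY-NAME seat of node N10 = [Balaban1988RG2Cluster]
Lemmas 1–3 pp. 9, 11, 20; statement of record `Dag.B13_main (DagBinding.leavesP w P)` = «b9 → b10 → b11 → b12 → b13»).  This is §7 of the seat's census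
`BalabanUVNodesN10RecordCensus` (v2, p425539: §§1–6 at ₅C ∕ ₇C ∕ ₈C ∕ ₉C + the generic regression tests `not_s_N10_of_swapClosed` ∕ `not_s_N10_of_s13SwapClosed`),
filed as a sibling module because Theorems files with proofs are capped at 400 lines (dag-lead WORDS-80: «ONE instance `not_s_N10_record₉CB10Y`, trigger = n08-a's
`BalabanUVNodesN08AtRecord9CB10`»).  BY NAME and UNCHANGED: node00-def g29's `Node00.CarriersB10` (`PrintedUV3V`, `Stage5Params.pinB10`, `upOfRecord₅C_pinB10_b10_iff`,
`isRecordOfRecord₉CB10_rebind_of_isRecordOfRecord₉C`) and `Node00.CarriersY` (`IsRecordOfRecord₉CB10Y`, `Y9OfRecord`, `Stage5Params.pinY`, `upOfRecord₅C_pinY_b10`,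
`leaf_b10_iff_of_isRecordOfRecord₉CB10Y`, `isRecordOfRecord₉C_of_isRecordOfRecord₉CB10Y`, `isRecordOfRecord₉CB10Y_rebind_of_isRecordOfRecord₉CB10`); def-Y's A5
certificate `B9PinCarriersNonVacuity.exists_ops_b9LeafX` (the ZERO operator layer) with its [B6] block hypothesis = N03 of record `Node00.b6BlockParam_D6OfRecord`;
NODE 00's N01 ∕ N02 ∕ N03 ∕ N04 at ₉C (`Node00.b4∕b5∕b7_main_of_isRecordOfRecord₉C`, `Node00.N03_at_record₅C` through `atWorld_of_isRecordOfRecord₉C`); this seat's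
`B13ResidualSlotProbe9` §1 (blindness of the Stage-9 provisos ∕ admissibility ∕ datum to `X, Y, Z`), `B13ResidualLeafProbe.exists_stepData_not_lemma1` (g5's junk step),
`B13NodeKnitRecord5C.inEdges_iff_res₅C` ∕ `b13_leaf_iff_res₅C`, n07-a's `B11LeafUnpinnedRecord.b8LeafR_of_isEmpty` ∕ `exists_b11Leaf` ∕ `upOfRecord₅C_b8_b9_b11`.
The N08 side is dag-n08-a's `BalabanUVNodesN08AtRecord9CB10` (p427365): its closer's CONCLUSION `S_N08 (₉CB10Y)` is consumed as a hypothesis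
(`not_s_N10_record₉CB10Y_of_s_N08`), and the named instance takes `b10` FROM THAT CLOSER BY NAME — `N08AtRecord9CB10.s_N08_record₉CB10Y_of_printedUV3V hUV` — so
its ONE socket `∀ L, Odd L → 1 < L → PrintedUV3V N L` (N08's object gap, typed not asserted) is the hypothesis `hUV` here.  THEOREMS ONLY (0 `def`, 0 `sorry`, standard
axioms); `--supports stmt-QuantumFields-19183`.

WHAT IS PROVED.
* **`exists_record₉CB10Y_sister`** — from ONE ₉CB10Y record `(D, w)`: a ₉CB10Y record over the SAME datum with the SAME block size `L` at every run of which EVERY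
  in-edge leaf of N08 and of N10 HOLDS (`b4 b5 b6 b7` theorems of NODE 00; `b8` on empty [B8] indices; `b9` def-Y's leaf at the bundle of record for the zero operator
  layer; `b11` a satisfying junk [B11] bundle; `b12` zero constants), `b13` FAILS (junk step), and `b10 ↔ PrintedUV3V N L` (the [B10] pin untouched: neither junk-true
  nor junk-false).
* **`not_printedUV3V_of_s_N10_record₉CB10Y`** ∕ **`not_b10_of_s_N10_record₉CB10Y`** — UNCONDITIONAL: if `S_N10 (₉CB10Y)` held, N08's slot `PrintedUV3V N L` would be
  FALSE at every block size a ₉CB10Y record presents, i.e. N08's own leaf false at every record — the exact negative of n08-a's `printedUV3V_of_s_N08_record₉CB10`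
  (N08's ∀-closer reads the slot back as TRUE at the same records).
* **`not_s_N08_and_s_N10_record₉CB10Y`** — given ONE ₉CB10Y record (inhabitation = W00's K0 through **`inhabited₉CB10Y_of_inhabited₉C`**: the pins add no proviso),
  `S_N08 (₉CB10Y) ∧ S_N10 (₉CB10Y)` is FALSE with NO hypothesis on Bałaban's theorems (`S_N08` feeds `b10` to the sister, `S_N10` then demands `b13` of junk);
  **`not_s_N10_record₉CB10Y_of_s_N08`**; **`not_flowBounds_and_renormalisationBeta_record₉CB10Y`** (the route's cluster pair K2 ∧ K3 is refutable at ₉CB10Y: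
  K3's node conjunct `Dag.B10_main`, K2's `Dag.B13_main`).
* **`not_s_N10_record₉CB10Y`** — THE NAMED INSTANCE: given (i) one ₉C record on some family (K0) and (ii) N08's object gap `∀ L, Odd L → 1 < L → PrintedUV3V N L`
  (the ONE socket of n08-a's `s_N08_record₉CB10Y_of_printedUV3V` ∕ g29's `b10_main_of_isRecordOfRecord₉CB10`), `S_N10 (₉CB10Y)` is FALSE.  READING: at ₉CB10Y the
  N10 stub is false exactly when [Balaban1985UV3] is true at a presented block size — pinning the [B10] and [B9] groups does NOT rescue the ∀-form; the stage that pins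
  the B13 group `(res.X P).S13 ∕ c13` (node00-def's `Record10Carriers` successor) is still the first that can pass.  **`not_s_N10_record₉CB10`** — the same one
  stage down at the [B10]-only pin (antitonicity along `IsRecordOfRecord₉CB10Y → ₉CB10`).
* **`isRecordOfRecord₉CB10Y_updS13`** — ₉CB10Y is CLOSED under swapping ONLY `(res.X P).S13`: clause (ii) (`hswap`) of the census' §6 regression test
  `BalabanUVNodesN10RecordCensus.not_s_N10_of_s13SwapClosed` SURVIVES both pins (`rfl`-level); **`exists_record₉CB10Y_inEdges`** — its clause (i) (`hinh`: one
  ₉CB10Y record and run with `b9 b10 b11 b12`) holds given K0-inhabitation and N08's object gap; `not_s_N10_of_s13SwapClosed N _ hinh hswap` is then the named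
  instance once more — NODE 00's cumulative pins FAIL the §6 test until the B13 group itself is pinned.

HONEST FRAMING: count-neutral bookkeeping over the route's stubs and NODE 00's record predicates; N10 NOT discharged and NOT refuted at Bałaban's objects — the refuting
records are DEGENERATE probes over free residual fields; N08's slot `PrintedUV3V` TYPED (g29), not asserted; one finite four-torus programme at fixed `ε`; nothing
continuum ∕ ℝ⁴ ∕ OS ∕ mass-gap ∕ Clay.
-/

noncomputable section

namespace Summit.QuantumFields.YangMills.Theorems.BalabanUVNodesN10RecordCensus9CB10Y

open Literature.MathematicalPhysics.QuantumFieldTheory.Balaban1983to89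
open Literature.MathematicalPhysics.QuantumFieldTheory.Balaban1983to89.T4Continuum (T4Family FiniteEpsData)
open Literature.MathematicalPhysics.QuantumFieldTheory.Balaban1983to89.DagBinding (WorldP leavesP PrintedCarriersR)
open Literature.MathematicalPhysics.QuantumFieldTheory.Balaban1983to89.Node00
  (Stage5Params Stage9Params upOfRecord₅C IsRecordOfRecord₉C IsRecordOfRecord₉CB10 IsRecordOfRecord₉CB10Y Y9OfRecord PrintedUV3V datumOfRecord₉
    isRecordOfRecord₉C_of_isRecordOfRecord₉CB10Y isRecordOfRecord₉CB10_rebind_of_isRecordOfRecord₉C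
    isRecordOfRecord₉CB10Y_rebind_of_isRecordOfRecord₉CB10 leaf_b10_iff_of_isRecordOfRecord₉CB10Y atWorld_of_isRecordOfRecord₉C
    b4_main_of_isRecordOfRecord₉C b5_main_of_isRecordOfRecord₉C b7_main_of_isRecordOfRecord₉C)
open Literature.MathematicalPhysics.QuantumFieldTheory.Balaban1983to89.B7Prop2SpecialUnitary (specialUnitaryUnits)
open YMDAG.UVSplit (S_N08 S_N10 FlowBounds RenormalisationBeta)
open scoped Matrix.Norms.L2Operator

variable {N : ℕ} [NeZero N]

/-! ## §1 The sister record at ₉CB10Y: every in-edge of N08 and N10 true, `b13` false, `b10` = N08's slot of record -/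

/-- **THE SISTER RECORD AT ₉CB10Y.**  Given ONE ₉CB10Y record `(D, w)` (parameters `θ`, provisos, floor `M⋆`, operator layer), there is a ₉CB10Y record over the
SAME datum with the SAME block size `L = θ.L` at every run of which EVERY in-edge leaf of N08 and of N10 HOLDS — `b4 b5 b6 b7` (NODE 00's theorems N01 ∕ N02 ∕
N03 ∕ N04 at the ₅C shadow), `b8` (empty [B8] indices, `B11LeafUnpinnedRecord.b8LeafR_of_isEmpty`), `b9` (def-Y's leaf AT THE BUNDLE OF RECORD `Y9OfRecord N θ₃ M⋆ ops₀`
for the ZERO operator layer `ops₀` of `B9PinCarriersNonVacuity.exists_ops_b9LeafX`, its [B6] block hypothesis = N03 of record `Node00.b6BlockParam_D6OfRecord`),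
`b11` (`B11LeafUnpinnedRecord.exists_b11Leaf`), `b12` (zero constants) —, `b13` FAILS (g5's junk step `B13ResidualLeafProbe.exists_stepData_not_lemma1`), and
`b10` IS N08's SLOT OF RECORD `PrintedUV3V N L` (g29's face; the [B10] pin is untouched).  Provisos, admissibility and the datum survive the swap of `X`'s free
groups and of `Z` (`B13ResidualSlotProbe9.provisos∕admissible∕datumOfRecord₉_updXYZ`); the operator layer is re-chosen (₉CB10Y quantifies it).
[cite: Balaban1988RG2Cluster, Lemmas 1–3 pp.9, 11, 20; p.1 (in-edges) (typed leaves at NODE 00's cumulative carrier-pin record ₉CB10Y; vacuity probe)] -/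
theorem exists_record₉CB10Y_sister {F : T4Family} {D : FiniteEpsData F (Node00.SU N)} {w : WorldP} (h : IsRecordOfRecord₉CB10Y F N D w) :
    ∃ (L : ℕ) (w' : WorldP), (Odd L ∧ 1 < L) ∧ w.L = (L : ℝ) ∧ w'.L = (L : ℝ) ∧ IsRecordOfRecord₉CB10Y F N D w' ∧
      ∀ P : B12.RunParams,
        ((leavesP w' P).b9 ∧ (leavesP w' P).b11 ∧ (leavesP w' P).b12 ∧ ¬ (leavesP w' P).b13) ∧
        ((leavesP w' P).b10 ↔ PrintedUV3V N L) ∧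
        ((leavesP w' P).b4 ∧ (leavesP w' P).b5 ∧ (leavesP w' P).b6 ∧ (leavesP w' P).b7 ∧ (leavesP w' P).b8) := by
  obtain ⟨θ, hP, Mstar, ops, hθ, hD, hC, hγ, hL, hup⟩ := h
  -- junk free carriers: a satisfying [B11] bundle, a refuting B13 step, empty [B8] indices, zero B12 constants
  obtain ⟨Z₁, -, hZ₁⟩ := B11LeafUnpinnedRecord.exists_b11Leaf
  let junk : B12.RunParams → B13.StepData := fun P =>
    Classical.choose (B13ResidualLeafProbe.exists_stepData_not_lemma1 ((θ.res.X P).c13))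
  have hjunk : ∀ P, ¬ B13.Lemma1Printed (junk P) ((θ.res.X P).c13) := fun P =>
    Classical.choose_spec (B13ResidualLeafProbe.exists_stepData_not_lemma1 ((θ.res.X P).c13))
  let X' : B12.RunParams → PrintedCarriersR := fun P =>
    { θ.res.X P with
      I8a := PEmpty, I8b := PEmpty, I8c := PEmpty, I8d := PEmpty, loc8 := fun i => i.elim, fam8 := fun i => i.elim,
      lan8 := fun i => i.elim, cub8 := fun i => i.elim, toAxial8 := fun i => i.elim, C140 := fun i => i.elim, InR := fun i => i.elim,
      proj140 := fun i => i.elim, c12 := ⟨0, 0, 0, 0, 0, 0, 0, 0, 0, 0⟩, S13 := junk P }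
  let θ₁ : Stage9Params F N := { θ with res := { θ.res with X := X', Y := θ.res.Y, Z := fun _ => Z₁ } }
  have hP₁ : θ₁.Provisos := B13ResidualSlotProbe9.provisos_updXYZ₉ hP X' θ.res.Y (fun _ => Z₁)
  have hθ₁ : θ₁.Admissible := B13ResidualSlotProbe9.admissible_updXYZ₉ hθ X' θ.res.Y (fun _ => Z₁)
  have hD₁ : datumOfRecord₉ F N θ₁ hP₁ = datumOfRecord₉ F N θ hP := B13ResidualSlotProbe9.datumOfRecord₉_updXYZ θ hP X' θ.res.Y (fun _ => Z₁)
  -- def-Y's A5 certificate: the ZERO operator layer over the record's Stage-3 geometry, [B6] block = N03 of record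
  obtain ⟨ops₀, -, hY⟩ := B9PinCarriersNonVacuity.exists_ops_b9LeafX (Mstar := Mstar) (Matrix (Fin N) (Fin N) ℂ) (specialUnitaryUnits (Fin N))
    _ _ _ (Node00.b6BlockParam_D6OfRecord θ.toStage3Params hθ.1.1.1.1)
  let θ₅ : Stage5Params F N := ((θ₁.toStage5 F N).pinB10 F N).pinY F N (Y9OfRecord N θ.toStage3Params Mstar ops₀)
  let w₁ : WorldP := { w with up := fun P => upOfRecord₅C F N θ₅ P }
  have hrec₁ : IsRecordOfRecord₉CB10Y F N D w₁ := ⟨θ₁, hP₁, Mstar, ops₀, hθ₁, hD.trans hD₁.symm, hC, hγ, hL, fun _ => rfl⟩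
  have h₉ := isRecordOfRecord₉C_of_isRecordOfRecord₉CB10Y hrec₁
  refine ⟨θ.L, w₁, θ.hL, hL, hL, hrec₁, fun P => ?_⟩
  have key := B13NodeKnitRecord5C.inEdges_iff_res₅C F N θ₅ w₁ P rfl
  have h13 := B13NodeKnitRecord5C.b13_leaf_iff_res₅C F N θ₅ w₁ P rfl
  have h8911 := B11LeafUnpinnedRecord.upOfRecord₅C_b8_b9_b11 θ₅ P
  have h4 : (leavesP w₁ P).b4 := b4_main_of_isRecordOfRecord₉C h₉ P
  have h5 : (leavesP w₁ P).b5 := b5_main_of_isRecordOfRecord₉C h₉ P h4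
  have h6 : (leavesP w₁ P).b6 := atWorld_of_isRecordOfRecord₉C (X := Dag.B6_main) (fun _ _ h5' Q => Node00.N03_at_record₅C h5' Q) h₉ P h4 h5
  have h7 : (leavesP w₁ P).b7 := b7_main_of_isRecordOfRecord₉C h₉ P h5
  have h8 : (leavesP w₁ P).b8 :=
    h8911.1.2 (@B11LeafUnpinnedRecord.b8LeafR_of_isEmpty _ _ _ _ (inferInstance : IsEmpty PEmpty) (inferInstance : IsEmpty PEmpty)
      (inferInstance : IsEmpty PEmpty) (inferInstance : IsEmpty PEmpty) _ _ _ _ _ _ _ _ _ _ _ _ _ _ _)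
  have h10 : (leavesP w₁ P).b10 ↔ PrintedUV3V N θ.L := by
    show (upOfRecord₅C F N (((θ₁.toStage5 F N).pinB10 F N).pinY F N (Y9OfRecord N θ.toStage3Params Mstar ops₀)) P).b10 ↔ _
    rw [Node00.upOfRecord₅C_pinY_b10]
    exact Node00.upOfRecord₅C_pinB10_b10_iff F N (θ₁.toStage5 F N) P
  exact ⟨⟨key.1.2 hY, key.2.2.1.2 hZ₁, key.2.2.2.2 fun hR => absurd hR.1 (lt_irrefl _), fun hb => hjunk P (h13.1 hb).1⟩, h10,
    h4, h5, h6, h7, h8⟩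

/-! ## §2 The N10 ∀-stub at ₉CB10Y denies N08's slot; N08's and N10's stubs are jointly unsatisfiable; K2 ∧ K3 refutable -/

/-- **THE N10 ∀-STUB AT ₉CB10Y DENIES N08's SLOT OF RECORD** (unconditional): if `S_N10 (IsRecordOfRecord₉CB10Y)` held, then at EVERY ₉CB10Y record and every block
size `L` it presents, [Balaban1985UV3] Thm 1 (compact) ∧ Thm 2 at some version of print's transformations — `Node00.PrintedUV3V N L` — would be FALSE (run the stub
at the sister record: `b9 → b10 → b11 → b12 → b13` with `b9 b11 b12` true and `b13` false forces `¬ b10`, i.e. `¬ PrintedUV3V N L`).  The exact negative of n08-a's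
`N08AtRecord9CB10.printedUV3V_of_s_N08_record₉CB10` (N08's ∀-closer reads the slot back as TRUE at the same records).
[cite: Balaban1988RG2Cluster, Lemmas 1–3 pp.9, 11, 20; Balaban1985UV3, Thm 1 p.257 + Thm 2 p.272 (bookkeeping: the universal N10 stub over ₉CB10Y contradicts the [B10] slot of record)] -/
theorem not_printedUV3V_of_s_N10_record₉CB10Y (hS : S_N10 (fun F D w => IsRecordOfRecord₉CB10Y F N D w))
    {F : T4Family} {D : FiniteEpsData F (Node00.SU N)} {w : WorldP} (h : IsRecordOfRecord₉CB10Y F N D w) {L : ℕ} (hwL : w.L = (L : ℝ)) :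
    ¬ PrintedUV3V N L := by
  intro hUV
  obtain ⟨L₁, w', -, hL₁, -, hrec', hl⟩ := exists_record₉CB10Y_sister h
  have hLL : L₁ = L := by exact_mod_cast hL₁.symm.trans hwL
  subst hLL
  obtain ⟨⟨h9, h11, h12, hn13⟩, h10, -⟩ := hl ⟨0, 0, 0⟩
  exact hn13 (hS F D w' hrec' ⟨0, 0, 0⟩ h9 (h10.2 hUV) h11 h12)

/-- **Hence the N10 ∀-stub at ₉CB10Y makes N08's OWN LEAF FALSE at every run of every ₉CB10Y record** (`b10 ↔ PrintedUV3V N L` at the record's block size,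
`Node00.leaf_b10_iff_of_isRecordOfRecord₉CB10Y`). [cite: Balaban1988RG2Cluster, Lemmas 1–3 pp.9, 11, 20; Balaban1985UV3, Thm 1 p.257 + Thm 2 p.272 (bookkeeping)] -/
theorem not_b10_of_s_N10_record₉CB10Y (hS : S_N10 (fun F D w => IsRecordOfRecord₉CB10Y F N D w))
    {F : T4Family} {D : FiniteEpsData F (Node00.SU N)} {w : WorldP} (h : IsRecordOfRecord₉CB10Y F N D w) (P : B12.RunParams) :
    ¬ (leavesP w P).b10 := by
  obtain ⟨L, -, hwL, hiff⟩ := leaf_b10_iff_of_isRecordOfRecord₉CB10Y h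
  exact fun h10 => not_printedUV3V_of_s_N10_record₉CB10Y hS h hwL ((hiff P).1 h10)

/-- **N08's AND N10's ∀-STUBS ARE JOINTLY UNSATISFIABLE AT ₉CB10Y** as soon as ONE ₉CB10Y record exists on some family — NO hypothesis on Bałaban's theorems:
at the sister record `S_N08` (`b5 → b6 → b7 → b8 → b9 → b11 → b10`) delivers `b10`, then `S_N10` (`b9 → b10 → b11 → b12 → b13`) demands `b13` of g5's junk step.  So
pinning the [B10] runs and the [B9] bundle does not make the node-cluster layer sound: the B13 group `(res.X P).S13 ∕ c13` must itself be pinned first.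
[cite: Balaban1988RG2Cluster, Lemmas 1–3 pp.9, 11, 20; Balaban1985UV3, Thm 1 p.257 + Thm 2 p.272 (bookkeeping: joint satisfiability of the route's N08 and N10 stubs over ₉CB10Y)] -/
theorem not_s_N08_and_s_N10_record₉CB10Y
    (hex : ∃ (F : T4Family) (D : FiniteEpsData F (Node00.SU N)) (w : WorldP), IsRecordOfRecord₉CB10Y F N D w) :
    ¬ (S_N08 (fun F D w => IsRecordOfRecord₉CB10Y F N D w) ∧ S_N10 (fun F D w => IsRecordOfRecord₉CB10Y F N D w)) := by
  rintro ⟨h08, h10⟩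
  obtain ⟨F, D, w, h⟩ := hex
  obtain ⟨L, w', -, -, -, hrec', hl⟩ := exists_record₉CB10Y_sister h
  obtain ⟨⟨h9, h11, h12, hn13⟩, -, -, h5, h6, h7, h8⟩ := hl ⟨0, 0, 0⟩
  exact hn13 (h10 F D w' hrec' ⟨0, 0, 0⟩ h9 (h08 F D w' hrec' ⟨0, 0, 0⟩ h5 h6 h7 h8 h9 h11) h11 h12)

/-- **`S_N10 (₉CB10Y)` is FALSE given ONE ₉CB10Y record and N08's ∀-stub there** (whose closer of record from the [B10] slot is n08-a's
`N08AtRecord9CB10.s_N08_record₉CB10Y_of_printedUV3V`). [cite: Balaban1988RG2Cluster, Lemmas 1–3 pp.9, 11, 20 (bookkeeping)] -/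
theorem not_s_N10_record₉CB10Y_of_s_N08
    (hex : ∃ (F : T4Family) (D : FiniteEpsData F (Node00.SU N)) (w : WorldP), IsRecordOfRecord₉CB10Y F N D w)
    (h08 : S_N08 (fun F D w => IsRecordOfRecord₉CB10Y F N D w)) : ¬ S_N10 (fun F D w => IsRecordOfRecord₉CB10Y F N D w) :=
  fun h10 => not_s_N08_and_s_N10_record₉CB10Y hex ⟨h08, h10⟩

/-- **Hence the route's CLUSTER PAIR K2 «FlowBounds» ∧ K3 «RenormalisationBeta» is REFUTABLE at ₉CB10Y** given one ₉CB10Y record (K3's fourth node conjunct is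
`Dag.B10_main`, K2's third is `Dag.B13_main`). [cite: Balaban1988RG2Cluster, Lemmas 1–3 pp.9, 11, 20 (bookkeeping over the route's cluster statements at ₉CB10Y)] -/
theorem not_flowBounds_and_renormalisationBeta_record₉CB10Y
    (hex : ∃ (F : T4Family) (D : FiniteEpsData F (Node00.SU N)) (w : WorldP), IsRecordOfRecord₉CB10Y F N D w) :
    ¬ (FlowBounds (fun F D w => IsRecordOfRecord₉CB10Y F N D w) ∧ RenormalisationBeta (fun F D w => IsRecordOfRecord₉CB10Y F N D w)) := by
  rintro ⟨hK2, hK3⟩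
  exact not_s_N08_and_s_N10_record₉CB10Y hex
    ⟨fun F D w hR P => ((hK3 F D w hR).1 P).2.2.2.1, fun F D w hR P => (hK2 F D w hR P).2.2.1⟩

/-! ## §3 The named instance `not_s_N10_record₉CB10Y` (dag-lead WORDS-80) -/

/-- **INHABITED-AT-₉CB10Y ⟸ INHABITED-AT-₉C** on a family (the two carrier pins add no proviso: re-bind a ₉C record's world by the [B10] pin, then by the [B9] pin at
ANY operator layer — e.g. def-Y's zero layer; `Node00.isRecordOfRecord₉CB10_rebind_of_isRecordOfRecord₉C`, `…₉CB10Y_rebind_of_isRecordOfRecord₉CB10`).  Inhabitation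
of ₉C is W00's item K0 «Record9Inhabited» — neither assumed nor proved in this file. [cite: Balaban1989LargeFieldII, Thm 1 + (0.1) pp.355–356 (bookkeeping: inhabitation of NODE 00's cumulative carrier-pin record)] -/
theorem inhabited₉CB10Y_of_inhabited₉C {F : T4Family} (hex : ∃ (D : FiniteEpsData F (Node00.SU N)) (w : WorldP), IsRecordOfRecord₉C F N D w) :
    ∃ (D : FiniteEpsData F (Node00.SU N)) (w : WorldP), IsRecordOfRecord₉CB10Y F N D w := by
  obtain ⟨D, w, h⟩ := hex
  obtain ⟨θ, _, -, -, h10⟩ := isRecordOfRecord₉CB10_rebind_of_isRecordOfRecord₉C h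
  obtain ⟨θ', _, hθ', -, hY⟩ := isRecordOfRecord₉CB10Y_rebind_of_isRecordOfRecord₉CB10 h10 0
  obtain ⟨ops₀, -, -⟩ := B9PinCarriersNonVacuity.exists_ops_b9LeafX (Mstar := 0) (Matrix (Fin N) (Fin N) ℂ) (specialUnitaryUnits (Fin N))
    _ _ _ (Node00.b6BlockParam_D6OfRecord θ'.toStage3Params hθ'.1.1.1.1)
  exact ⟨D, _, hY ops₀⟩

/-- **THE ₉CB10Y INSTANCE (dag-lead WORDS-80): `S_N10` at NODE 00's cumulative carrier-pin record `IsRecordOfRecord₉CB10Y` is FALSE**, given (i) ONE ₉C record on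
some family (W00's K0) and (ii) N08's object gap — the ONE socket `∀ L, Odd L → 1 < L → Node00.PrintedUV3V N L` of n08-a's closer of record
`N08AtRecord9CB10.s_N08_record₉CB10Y_of_printedUV3V` (consumed BY NAME: `S_N08 (₉CB10Y)` from the socket, then `not_s_N10_record₉CB10Y_of_s_N08`).  Reading: at ₉CB10Y the N10 stub is false exactly when [Balaban1985UV3] is true at a presented block size — the
pins of the [B10] and [B9] groups do NOT rescue the ∀-form; the B13 pin is still the first stage that can pass.
[cite: Balaban1988RG2Cluster, Lemmas 1–3 pp.9, 11, 20; Balaban1985UV3, Thm 1 p.257 + Thm 2 p.272 (bookkeeping: the universal N10 stub over NODE 00's ₉CB10Y record is refutable)] -/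
theorem not_s_N10_record₉CB10Y
    (hex : ∃ (F : T4Family) (D : FiniteEpsData F (Node00.SU N)) (w : WorldP), IsRecordOfRecord₉C F N D w)
    (hUV : ∀ L : ℕ, Odd L → 1 < L → PrintedUV3V N L) : ¬ S_N10 (fun F D w => IsRecordOfRecord₉CB10Y F N D w) := by
  obtain ⟨F, hexF⟩ := hex
  exact not_s_N10_record₉CB10Y_of_s_N08 ⟨F, inhabited₉CB10Y_of_inhabited₉C hexF⟩
    (BalabanUVNodes.N08AtRecord9CB10.s_N08_record₉CB10Y_of_printedUV3V hUV)

/-- **… and one stage down, at the [B10]-only pin `Node00.IsRecordOfRecord₉CB10`** (the [B9] bundle still residual there): `S_N10` is ANTITONE in the record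
predicate and every ₉CB10Y record is a ₉CB10 record with the same datum and world (`Node00.isRecordOfRecord₉CB10_of_isRecordOfRecord₉CB10Y`), so the stub at ₉CB10 is
FALSE under the same two hypotheses. [cite: Balaban1988RG2Cluster, Lemmas 1–3 pp.9, 11, 20 (bookkeeping: the universal N10 stub over NODE 00's ₉CB10 record is refutable)] -/
theorem not_s_N10_record₉CB10
    (hex : ∃ (F : T4Family) (D : FiniteEpsData F (Node00.SU N)) (w : WorldP), IsRecordOfRecord₉C F N D w)
    (hUV : ∀ L : ℕ, Odd L → 1 < L → PrintedUV3V N L) : ¬ S_N10 (fun F D w => IsRecordOfRecord₉CB10 F N D w) :=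
  fun h => not_s_N10_record₉CB10Y hex hUV fun F D w hR P => h F D w (Node00.isRecordOfRecord₉CB10_of_isRecordOfRecord₉CB10Y hR) P

/-! ## §4 ₉CB10Y is `S13`-swap-closed: the census' §6 regression test instantiated literally -/

/-- **₉CB10Y IS CLOSED UNDER SWAPPING ONLY THE RESIDUAL B13 STEP `(res.X P).S13`** — clause (ii) of the census' §6 test `BalabanUVNodesN10RecordCensus.not_s_N10_of_s13SwapClosed` SURVIVES the [B10] and
[B9] pins (they overwrite `I10 ∕ runs10` and `Y` only; provisos, admissibility, datum, floor and operator layer untouched): re-binding a ₉CB10Y record's world over its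
own pinned Stage-5 view with ANY family of B13 steps is again a ₉CB10Y record over the SAME datum.
[cite: Balaban1988RG2Cluster, Lemmas 1–3 pp.9, 11, 20 (bookkeeping over NODE 00's ₉CB10Y record predicate: the B13 group is residual)] -/
theorem isRecordOfRecord₉CB10Y_updS13 {F : T4Family} {D : FiniteEpsData F (Node00.SU N)} {w : WorldP} (h : IsRecordOfRecord₉CB10Y F N D w) :
    ∃ θ₅ : Stage5Params F N, (∀ P, w.up P = upOfRecord₅C F N θ₅ P) ∧
      ∀ S' : B12.RunParams → B13.StepData, ∃ D' : FiniteEpsData F (Node00.SU N),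
        IsRecordOfRecord₉CB10Y F N D'
          { w with
            up := fun P => upOfRecord₅C F N ({ θ₅ with res := { θ₅.res with X := fun P => { θ₅.res.X P with S13 := S' P } } } : Stage5Params F N) P } := by
  obtain ⟨θ, hP, Mstar, ops, hθ, hD, hC, hγ, hL, hup⟩ := h
  refine ⟨((θ.toStage5 F N).pinB10 F N).pinY F N (Y9OfRecord N θ.toStage3Params Mstar ops), hup, fun S' => ⟨D, ?_⟩⟩
  let X' : B12.RunParams → PrintedCarriersR := fun P => { θ.res.X P with S13 := S' P }
  refine ⟨{ θ with res := { θ.res with X := X', Y := θ.res.Y, Z := θ.res.Z } }, B13ResidualSlotProbe9.provisos_updXYZ₉ hP X' θ.res.Y θ.res.Z,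
    Mstar, ops, B13ResidualSlotProbe9.admissible_updXYZ₉ hθ X' θ.res.Y θ.res.Z, ?_, hC, hγ, hL, fun _ => rfl⟩
  rw [B13ResidualSlotProbe9.datumOfRecord₉_updXYZ]
  exact hD

/-- **Clause (i) (`hinh`) of the census' §6 test at ₉CB10Y**: given one ₉C record on the family (K0) and N08's object gap, there is a ₉CB10Y record and a run at which
the four in-edge leaves `b9 b10 b11 b12` of N10 HOLD (the sister record; `b10` from the slot at the presented block size).  With `isRecordOfRecord₉CB10Y_updS13` as
clause (ii), `BalabanUVNodesN10RecordCensus.not_s_N10_of_s13SwapClosed N _ hinh hswap` is `not_s_N10_record₉CB10Y` again: NODE 00's cumulative carrier pins FAIL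
the §6 test, as every stage must until `(res.X P).S13 ∕ c13` are objects of the record. [cite: Balaban1988RG2Cluster, Lemmas 1–3 pp.9, 11, 20; p.1 (in-edges) (bookkeeping: §6's test instantiated at ₉CB10Y)] -/
theorem exists_record₉CB10Y_inEdges {F : T4Family} (hex : ∃ (D : FiniteEpsData F (Node00.SU N)) (w : WorldP), IsRecordOfRecord₉C F N D w)
    (hUV : ∀ L : ℕ, Odd L → 1 < L → PrintedUV3V N L) :
    ∃ (D : FiniteEpsData F (Node00.SU N)) (w : WorldP), IsRecordOfRecord₉CB10Y F N D w ∧ ∃ P : B12.RunParams,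
      (leavesP w P).b9 ∧ (leavesP w P).b10 ∧ (leavesP w P).b11 ∧ (leavesP w P).b12 := by
  obtain ⟨D, w, h⟩ := inhabited₉CB10Y_of_inhabited₉C hex
  obtain ⟨L, w', hLo, -, -, hrec', hl⟩ := exists_record₉CB10Y_sister h
  obtain ⟨⟨h9, h11, h12, -⟩, h10, -⟩ := hl ⟨0, 0, 0⟩
  exact ⟨D, w', hrec', ⟨0, 0, 0⟩, h9, h10.2 (hUV L hLo.1 hLo.2), h11, h12⟩

end Summit.QuantumFields.YangMills.Theorems.BalabanUVNodesN10RecordCensus9CB10Y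

end
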